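import Summits.PneNP.PneNP.Theorems.KarlinRubinMonotoneBlindFormBlind
import Summits.PneNP.PneNP.Theorems.KarlinRubinMonotoneBlindStubBlindAndDnf

/-!
# Route KarlinRubin, crux `MonotoneBlind` (stmt-PneNP-18027): weak blindness of ORs of CNFs (the lead's `stub_weakBlindOrCnf`)

A corollary of the constant-depth theorem (`karlinRubin_constDepth_planted_le_null_add`, `…FormBlind`): an OR of
`m n ≤ n^c` monotone CNFs with `≤ n^c` clauses each (clauses of any width) is the level-`4` layered formula
AND[ OR_i AND_{S ∈ 𝓒 n i} OR_{e ∈ S} AND{e} ] with fan-ins `≤ n^{c+2}` above single slots, so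
`Pr_{G(n,1/2,⌈n^{1/2-δ}⌉)}[f_n] ≤ Pr_{G(n,1/2)}[f_n] + 4/n` eventually — weak blindness with `ε n = 4/n`, no quietness.

All `--supports stmt-PneNP-18027`; no definitions.
-/

set_option linter.dupNamespace false -- `Summit.PneNP.PneNP.…`: summit = sub-problem (D-0017)

namespace Summit.PneNP.PneNP.Theorems

open Finset Filter Topology
open scoped ENNReal
open Literature.Computability.Complexity
open Literature.Probability.RandomGraphs.PlantedClique

variable {n : ℕ}

/-- The level-`3` layered formula (top gate OR) of an OR of CNFs. [folklore] -/
theorem swEval_orCnf {m : ℕ} (𝓒 : Fin m → Finset (Finset (⊤ : SimpleGraph (Fin n)).edgeSet)) (x : EdgeVec n) :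
    swEval 3 true (swForm.node (List.ofFn fun i => swForm.node ((𝓒 i).toList.map fun S =>
      swForm.node (S.toList.map fun e => swForm.leaf {e})))) x ↔ ∃ i, ∀ S ∈ 𝓒 i, ∃ e ∈ S, x e = true := by
  rw [swEval_succ_true]
  simp only [swForm.kids, List.mem_ofFn, exists_exists_eq_and]
  refine exists_congr fun i => ?_
  rw [swEval_succ_false]
  simp only [swForm.kids, List.mem_map, Finset.mem_toList, forall_exists_index, and_imp, forall_apply_eq_imp_iff₂]
  refine forall₂_congr fun S _ => ?_
  rw [swEval_succ_true]
  simp only [swForm.kids, List.mem_map, Finset.mem_toList, exists_exists_and_eq_and]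
  refine exists_congr fun e => and_congr_right fun _ => ?_
  rw [swEval_zero_false]
  simp [swForm.leaf, swForm.sets]

/-- Its fan-ins are `≤ max (m, #clauses, #slots)` above single slots. [folklore] -/
theorem swBnd_orCnf {m M : ℕ} (𝓒 : Fin m → Finset (Finset (⊤ : SimpleGraph (Fin n)).edgeSet)) (hm : m ≤ M)
    (h𝓒 : ∀ i, #(𝓒 i) ≤ M) (hE : Fintype.card (⊤ : SimpleGraph (Fin n)).edgeSet ≤ M) :
    swBnd M 1 3 (swForm.node (List.ofFn fun i => swForm.node ((𝓒 i).toList.map fun S =>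
      swForm.node (S.toList.map fun e => swForm.leaf {e})))) := by
  rw [swBnd_succ]
  refine ⟨by simpa [swForm.kids] using hm, fun g hg => ?_⟩
  simp only [swForm.kids, List.mem_ofFn] at hg
  obtain ⟨i, rfl⟩ := hg
  rw [swBnd_succ]
  refine ⟨by simpa [swForm.kids] using h𝓒 i, fun g hg => ?_⟩
  simp only [swForm.kids, List.mem_map, Finset.mem_toList] at hg
  obtain ⟨S, -, rfl⟩ := hg
  rw [swBnd_succ]
  refine ⟨?_, fun g hg => ?_⟩
  · rw [swForm.kids, List.length_map, Finset.length_toList]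
    exact (card_le_univ S).trans hE
  · simp only [swForm.kids, List.mem_map, Finset.mem_toList] at hg
    obtain ⟨e, -, rfl⟩ := hg
    rw [swBnd_zero]
    simp [swForm.leaf, swForm.sets]

/-- **Weak blindness of polynomial ORs of polynomial monotone CNFs** (`ε n = 4/n`, no quietness). [folklore] -/
theorem karlinRubin_weakBlindOrCnf {δ : ℝ} (hδ : 0 < δ) (hδ' : δ < 1 / 2) (c : ℕ) (m : ℕ → ℕ)
    (𝓒 : (n : ℕ) → Fin (m n) → Finset (Finset (⊤ : SimpleGraph (Fin n)).edgeSet))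
    (hm : ∀ᶠ n : ℕ in atTop, m n ≤ n ^ c) (h𝓒 : ∀ᶠ n : ℕ in atTop, ∀ i, #(𝓒 n i) ≤ n ^ c) :
    ∃ ε : ℕ → ℝ≥0∞, Tendsto ε atTop (𝓝 0) ∧ ∀ᶠ n : ℕ in atTop,
      (plantedCliqueDist n ⌈(n : ℝ) ^ (1 / 2 - δ)⌉₊).toOuterMeasure {x | ∃ i, ∀ S ∈ 𝓒 n i, ∃ e ∈ S, x e = true} ≤
        (erdosRenyiHalf n).toOuterMeasure {x | ∃ i, ∀ S ∈ 𝓒 n i, ∃ e ∈ S, x e = true} + ε n := by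
  set f : (n : ℕ) → swForm n 4 := fun n => swForm.node [swForm.node (List.ofFn fun i =>
    swForm.node ((𝓒 n i).toList.map fun S => swForm.node (S.toList.map fun e => swForm.leaf {e})))] with hf
  have hsem : ∀ n (x : EdgeVec n), swEval 4 false (f n) x ↔ ∃ i, ∀ S ∈ 𝓒 n i, ∃ e ∈ S, x e = true := by
    intro n x
    rw [hf, swEval_succ_false]
    simp only [swForm.kids, List.mem_singleton, forall_eq]
    exact swEval_orCnf (𝓒 n) x
  have hbnd : ∀ᶠ n : ℕ in atTop, swBnd (n ^ (c + 2)) 1 4 (f n) := by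
    filter_upwards [hm, h𝓒, eventually_ge_atTop 1] with n hmn h𝓒n hn1
    have h1 : n ^ c ≤ n ^ (c + 2) := Nat.pow_le_pow_right hn1 (by omega)
    have h2 : n ^ 2 ≤ n ^ (c + 2) := Nat.pow_le_pow_right hn1 (by omega)
    rw [hf, swBnd_succ]
    refine ⟨?_, fun g hg => ?_⟩
    · simpa [swForm.kids] using Nat.one_le_pow _ _ hn1
    · simp only [swForm.kids, List.mem_singleton] at hg
      subst hg
      exact swBnd_orCnf (𝓒 n) (hmn.trans h1) (fun i => (h𝓒n i).trans h1)
        ((MonotoneBlind.VertexCover.card_edgeSet_top_le_sq n).trans h2)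
  refine ⟨fun n => ((3 + 1 : ℕ) : ℝ≥0∞) * ((n : ℝ≥0∞))⁻¹, ?_, ?_⟩
  · have h := ENNReal.Tendsto.const_mul ENNReal.tendsto_inv_nat_nhds_zero
      (Or.inr (ENNReal.natCast_ne_top _) : (0 : ℝ≥0∞) ≠ 0 ∨ ((3 + 1 : ℕ) : ℝ≥0∞) ≠ ⊤)
    simpa using h
  · filter_upwards [karlinRubin_constDepth_planted_le_null_add hδ hδ' (c + 2) 3 f hbnd] with n hn
    have hset : {x : EdgeVec n | ∃ i, ∀ S ∈ 𝓒 n i, ∃ e ∈ S, x e = true} = {x | swEval 4 false (f n) x} := by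
      ext x; exact (hsem n x).symm
    rw [hset]
    exact hn

/-- **stub_weakBlindOrCnf** (registered stub of the lead's line `Sketch`, crux stmt-PneNP-18027): weak blindness of
polynomial ORs of polynomial monotone CNFs — here a corollary of the constant-depth theorem. [folklore] -/
theorem stub_weakBlindOrCnf : ∀ δ : ℝ, 0 < δ → δ < 1 / 2 → ∀ c : ℕ, ∀ m : ℕ → ℕ, ∀ 𝓒 : (n : ℕ) → Fin (m n) → Finset (Finset ((⊤ : SimpleGraph (Fin n)).edgeSet)), (∀ᶠ n : ℕ in atTop, m n ≤ n ^ c) → (∀ᶠ n : ℕ in atTop, ∀ i, #(𝓒 n i) ≤ n ^ c) → ∃ ε : ℕ → ℝ≥0∞, Tendsto ε atTop (𝓝 0) ∧ ∀ᶠ n : ℕ in atTop, (plantedCliqueDist n ⌈(n : ℝ) ^ (1 / 2 - δ)⌉₊).toOuterMeasure {x | ∃ i, ∀ S ∈ 𝓒 n i, ∃ e ∈ S, x e = true} ≤ (erdosRenyiHalf n).toOuterMeasure {x | ∃ i, ∀ S ∈ 𝓒 n i, ∃ e ∈ S, x e = true} + ε n :=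
  fun _ hδ hδ' c m 𝓒 hm h𝓒 => karlinRubin_weakBlindOrCnf hδ hδ' c m 𝓒 hm h𝓒

end Summit.PneNP.PneNP.Theorems
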